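import Summits.ABC.IUTFork.FreeProfiniteUniqueRootsNoGo
import Mathlib.GroupTheory.IndexNormal
import HarnessLib

/-!
# The typed right-hand side of [AbsTopII] Cor. 3.3 (ii) is EMPTY at every genuine semi-elliptic datum

Cell `abc-iut` (run/shared/lean/pub/abc-iut/), layers L4/L5 — PROOF-ONLY companion of
`Summits/ABC/IUTFork/FreeProfiniteUniqueRootsNoGo.lean` (★ p493804, abc-iut-L4-t12): the OTHER half of
finding T1g11-F1 (abc-iut-L5-t1) / census R43 «L5-ISMULTORSIONFREE-SWEEP» (abc-iut-f-052 g10).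

[AbsTopII] Cor. 3.3 (ii) p. 68 (Mochizuki, *Topics in Absolute Anabelian Geometry II*, lit key
`paper:url-585b8d0ad0d9`) characterises "the collection of open subgroups `J ⊆ Π_C` of index `2` such
that `J ∩ Δ_C` is torsion-free [i.e., the covering determined by `J` is a scheme — cf. [AbsTopI],
Lemma 4.1, (iv)]"; the tree types it as `AbsTopII.semiEllipticDoubleCoverSubgroups C :=
{J | IsOpen J ∧ J.index = 2 ∧ IsMulTorsionFree ↥(J ⊓ Δ_C)}` (F-0234 vocabulary, DEFS-frozen) with
Mathlib's UNIQUE-ROOTS class `IsMulTorsionFree`.  p493804 shows `Π_X ∉` this collection when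
`Δ_X = Π_X ∩ Δ_C` is free pro-`Σ` of rank `≥ 2`, `2, 3 ∈ Σ`.  This file shows the collection is then
EMPTY altogether:
* `exists_surjective_S3_of_index_dvd_two_of_isFreeProOn` — in a free pro-`Σ` group of rank `≥ 2` with
  `2, 3 ∈ Σ`, EVERY subgroup of index dividing `2` surjects onto `S₃` with open kernel (the three
  index-`2` kernels are handled by explicit generator assignments `a ↦ σ, b ↦ τ` / `a ↦ τ, b ↦ σ` /
  `a ↦ σ, b ↦ σ⁻¹τ`; the image contains elements of orders `3` and `2`, hence is `S₃` by Lagrange);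
* **`semiEllipticDoubleCoverSubgroups_eq_empty_of_isFreeProOn`** — for `C : FundamentalExtension` with
  an open `P ⊆ Π_C` whose `P ∩ Δ_C` is free pro-`Σ` of rank `≥ 2`, `2, 3 ∈ Σ` (print's `P = Π_X`, the
  double covering by the once-punctured elliptic curve), `semiEllipticDoubleCoverSubgroups C = ∅`: for
  an open `J` of index `2`, `J ∩ (P ∩ Δ_C)` has index `∣ 2` in `P ∩ Δ_C`, so it surjects onto `S₃`, so
  it is not `IsMulTorsionFree` (p493804 `not_isMulTorsionFree_of_surjective_S3`), so neither is the
  overgroup `J ∩ Δ_C` (`Function.Injective.isMulTorsionFree`);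
* `cor12_semiEllipticDoubleCoverSubgroups_eq_empty_of_isFreeProOn`, **`cor12_huniq'_of_isFreeProOn`**
  — at `D : PuncturedEllipticData` ([IUTchI] §1) under the origin datum "(A) `Δ_X` free profinite on
  `n ≥ 2` generators", the legacy LAW binder
  `huniq′ : ∀ J ∈ semiEllipticDoubleCoverSubgroups Π_C, J ⊓ Δ_C = Π_X ⊓ Δ_C` of the [IUTchI] Cor. 1.2
  closer chain (20 L5 theorems, census R43 §A rows 2–21; CERT conjuncts `layer5_held_cor12_v3…v6`) holds
  TRIVIALLY — it quantifies over the empty set.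
READING (numbers, not adjectives): of the two [AbsTopII] Cor. 3.3 (ii)-side LAW binders displayed by the
L5-d4 closer chain, `htf` is UNSATISFIABLE at (A) (p493804 `cor12_htf_false_of_isFreeProOn`) and `huniq′`
is CONTENT-FREE at (A′) (this file); the print-faithful successors (`semiEllipticDoubleCoverSubgroupsTF`,
★ p492999 / ★ p494272 / ★ p494944) are unaffected.  HONEST FRAMING: elementary (pro)finite group theory;
vacuous/empty AS TYPED at OUR predicate, not a statement about print (print's collection — the `Π_D` of the
"finite étale double coverings `D → C` that exhibit `C` as semi-elliptic", Cor. 3.3 (ii) p. 68 — is NON-empty: it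
contains `Π_X`, and all its members share the geometric part `Δ_X`, "the unique [up to isomorphism over `C_k̄`]
finite étale double covering of `C_k̄` by a hyperbolic curve", [AbsTopII] Rmk. 3.1.1 p. 65); nothing here bears
on [IUTchIII] Cor. 3.12; typed ≠ proved elsewhere.
-/

noncomputable section

open Topology Equiv Equiv.Perm

namespace Summit.ABC.IUTFork

open Literature.AnabelianGeometry.AbsoluteAnabelian

universe u

/-! ### `S₃` bookkeeping -/

/-- The square of the `3`-cycle `(0 1 2)` has order `3`. [folklore] -/
private theorem orderOf_sigma_sq :
    orderOf ((swap 0 1 * swap 1 2) * (swap 0 1 * swap 1 2) : Perm (Fin 3)) = 3 :=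
  orderOf_eq_prime (by decide) (by decide)

/-- The transposition `(0 1)` has order `2`. [folklore] -/
private theorem orderOf_tau : orderOf (swap 0 1 : Perm (Fin 3)) = 2 :=
  orderOf_eq_prime (by decide) (by decide)

/-- A subgroup of `S₃` containing an element of order `3` and an element of order `2` is all of `S₃`
(Lagrange: `6 ∣ |K| ≤ 6`). [folklore] -/
private theorem subgroup_S3_eq_top {K : Subgroup (Perm (Fin 3))} {x y : Perm (Fin 3)} (hx : x ∈ K)
    (hy : y ∈ K) (hx3 : orderOf x = 3) (hy2 : orderOf y = 2) : K = ⊤ := by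
  have h3 : 3 ∣ Nat.card K := by have h := K.orderOf_dvd_natCard hx; rwa [hx3] at h
  have h2 : 2 ∣ Nat.card K := by have h := K.orderOf_dvd_natCard hy; rwa [hy2] at h
  have h6 : 6 ∣ Nat.card K :=
    Nat.Coprime.mul_dvd_of_dvd_of_dvd (by norm_num : Nat.Coprime 2 3) h2 h3
  have hG : Nat.card (Perm (Fin 3)) = 6 := by
    rw [Nat.card_eq_fintype_card, Fintype.card_perm, Fintype.card_fin]; rfl
  have hle : Nat.card K ≤ 6 := hG ▸ Subgroup.card_le_card_group K
  have hge : 6 ≤ Nat.card K := Nat.le_of_dvd Nat.card_pos h6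
  exact Subgroup.eq_top_of_card_eq K (by omega)

section FreePro

variable {G : Type u} [Group G] [TopologicalSpace G]
variable {S : Set ℕ} {n : ℕ} {gens : Fin n → G}

/-- Universal property of a free pro-`Σ` group of rank `≥ 2`, `2, 3 ∈ Σ`, towards `S₃`: a homomorphism
with open kernel and PRESCRIBED values on the first two generators ([AbsTopI] Lem. 4.5 (i) vocabulary
`IsFreeProOn`; `S₃` is a finite `{2, 3}`-group). [cite: MochizukiAbsTopI2012, Lemma 4.5 (i) p.54] -/
theorem exists_hom_S3_apply_eq_of_isFreeProOn (h : IsFreeProOn G S gens) (h2 : 2 ∈ S) (h3 : 3 ∈ S)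
    (i0 i1 : Fin n) (hi0 : (i0 : ℕ) = 0) (hi1 : (i1 : ℕ) = 1) (x y : Perm (Fin 3)) :
    ∃ φ : G →* Perm (Fin 3), IsOpen (φ.ker : Set G) ∧ φ (gens i0) = x ∧ φ (gens i1) = y := by
  classical
  letI : TopologicalSpace (Perm (Fin 3)) := ⊥
  haveI : DiscreteTopology (Perm (Fin 3)) := ⟨rfl⟩
  have hK : ∀ q : ℕ, q.Prime → q ∣ Nat.card (Perm (Fin 3)) → q ∈ S := by
    intro q hq hdvd
    rw [Nat.card_eq_fintype_card, Fintype.card_perm, Fintype.card_fin] at hdvd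
    have h6 : q ∣ 2 * 3 := by simpa [Nat.factorial] using hdvd
    rcases (Nat.Prime.dvd_mul hq).mp h6 with h | h
    · rwa [(Nat.prime_dvd_prime_iff_eq hq Nat.prime_two).mp h]
    · rwa [(Nat.prime_dvd_prime_iff_eq hq Nat.prime_three).mp h]
  let f : Fin n → Perm (Fin 3) := fun i =>
    if (i : ℕ) = 0 then x else if (i : ℕ) = 1 then y else 1
  obtain ⟨φ, ⟨hφc, hφf⟩, -⟩ := h.2 (Perm (Fin 3)) hK f
  refine ⟨φ, ?_, ?_, ?_⟩
  · have : (φ.ker : Set G) = φ ⁻¹' {1} := by ext z; simp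
    rw [this]
    exact (isOpen_discrete _).preimage hφc
  · rw [hφf]; simp [f, hi0]
  · rw [hφf]; simp [f, hi1]

/-- **In a free pro-`Σ` group of rank `≥ 2` with `2, 3 ∈ Σ`, every subgroup of index dividing `2`
surjects onto `S₃` with open kernel.**  The three index-`2` subgroups `H = Ker(χ)` (`χ(a), χ(b)` not
both trivial) and `H = G` are handled uniformly: `a² ∈ H` always, and one chooses the generator
assignment so that an element of `H` (`b`, `a`, or `ab`) hits a transposition while `a²` hits a
`3`-cycle. [cite: MochizukiAbsTopI2012, Lemma 4.5 (i) p.54] -/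
theorem exists_surjective_S3_of_index_dvd_two_of_isFreeProOn (h : IsFreeProOn G S gens) (hn : 2 ≤ n)
    (h2 : 2 ∈ S) (h3 : 3 ∈ S) (H : Subgroup G) (hH : H.index ∣ 2) :
    ∃ ψ : ↥H →* Perm (Fin 3), IsOpen (ψ.ker : Set ↥H) ∧ Function.Surjective ψ := by
  classical
  -- squares lie in `H`; two non-members multiply into `H`
  have hsq : ∀ g : G, g * g ∈ H := by
    intro g
    rcases (Nat.dvd_prime Nat.prime_two).mp hH with h1 | h2'
    · rw [Subgroup.index_eq_one.mp h1]; exact Subgroup.mem_top _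
    · exact (Subgroup.mul_mem_iff_of_index_two h2').mpr Iff.rfl
  have hprod : ∀ g g' : G, g ∉ H → g' ∉ H → g * g' ∈ H := by
    intro g g' hg hg'
    rcases (Nat.dvd_prime Nat.prime_two).mp hH with h1 | h2'
    · exact absurd (by rw [Subgroup.index_eq_one.mp h1]; exact Subgroup.mem_top _) hg
    · exact (Subgroup.mul_mem_iff_of_index_two h2').mpr (iff_of_false hg hg')
  -- reduction: a homomorphism with open kernel hitting orders `3` and `2` on `H`
  suffices key : ∃ (φ : G →* Perm (Fin 3)) (h₁ h₂ : G), IsOpen (φ.ker : Set G) ∧ h₁ ∈ H ∧ h₂ ∈ H ∧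
      orderOf (φ h₁) = 3 ∧ orderOf (φ h₂) = 2 by
    obtain ⟨φ, h₁, h₂, hker, hh₁, hh₂, ho₁, ho₂⟩ := key
    refine ⟨φ.comp H.subtype, ?_, ?_⟩
    · have : ((φ.comp H.subtype).ker : Set ↥H) = Subtype.val ⁻¹' (φ.ker : Set G) := by
        ext z; simp [MonoidHom.mem_ker]
      rw [this]
      exact hker.preimage continuous_subtype_val
    · rw [← MonoidHom.range_eq_top]
      exact subgroup_S3_eq_top (MonoidHom.mem_range.mpr ⟨⟨h₁, hh₁⟩, rfl⟩)
        (MonoidHom.mem_range.mpr ⟨⟨h₂, hh₂⟩, rfl⟩) ho₁ ho₂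
  -- the first two free generators `a := gens i0`, `b := gens i1`
  let i0 : Fin n := ⟨0, by omega⟩
  let i1 : Fin n := ⟨1, by omega⟩
  by_cases hbH : gens i1 ∈ H
  · obtain ⟨φ, hker, hφa, hφb⟩ :=
      exists_hom_S3_apply_eq_of_isFreeProOn h h2 h3 i0 i1 rfl rfl (swap 0 1 * swap 1 2) (swap 0 1)
    refine ⟨φ, gens i0 * gens i0, gens i1, hker, hsq _, hbH, ?_, ?_⟩
    · rw [map_mul, hφa]; exact orderOf_sigma_sq
    · rw [hφb]; exact orderOf_tau
  by_cases haH : gens i0 ∈ H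
  · obtain ⟨φ, hker, hφa, hφb⟩ :=
      exists_hom_S3_apply_eq_of_isFreeProOn h h2 h3 i0 i1 rfl rfl (swap 0 1) (swap 0 1 * swap 1 2)
    refine ⟨φ, gens i1 * gens i1, gens i0, hker, hsq _, haH, ?_, ?_⟩
    · rw [map_mul, hφb]; exact orderOf_sigma_sq
    · rw [hφa]; exact orderOf_tau
  · obtain ⟨φ, hker, hφa, hφb⟩ :=
      exists_hom_S3_apply_eq_of_isFreeProOn h h2 h3 i0 i1 rfl rfl (swap 0 1 * swap 1 2)
        ((swap 0 1 * swap 1 2)⁻¹ * swap 0 1)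
    refine ⟨φ, gens i0 * gens i0, gens i0 * gens i1, hker, hsq _, hprod _ _ haH hbH, ?_, ?_⟩
    · rw [map_mul, hφa]; exact orderOf_sigma_sq
    · rw [map_mul, hφa, hφb, mul_inv_cancel_left]; exact orderOf_tau

end FreePro

section Cor33

open AbsTopII

variable (C : FundamentalExtension.{u})

/-- **The typed RHS of [AbsTopII] Cor. 3.3 (ii) is EMPTY** whenever `Π_C` has an open subgroup `P`
(print: `Π_X`, [AbsTopII] Rmk. 3.1.1) with `P ∩ Δ_C` free pro-`Σ` of rank `≥ 2`, `2, 3 ∈ Σ` ([AbsTopI]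
Lem. 4.5 (i): the geometric fundamental group of a once-punctured elliptic curve): for every open `J`
of index `2`, `J ∩ P ∩ Δ_C` has index `∣ 2` in `P ∩ Δ_C`, surjects onto `S₃`, hence is not
`IsMulTorsionFree`, hence neither is `J ∩ Δ_C ⊇ J ∩ P ∩ Δ_C` — so "`J ∩ Δ_C` is torsion-free" AS TYPED
(unique roots) fails for EVERY candidate `J`. [cite: MochizukiAbsTopII2013, Cor 3.3 (ii) p.68] -/
theorem semiEllipticDoubleCoverSubgroups_eq_empty_of_isFreeProOn (P : Subgroup C.arith)
    (hP : IsOpen (P : Set C.arith)) {S : Set ℕ} {n : ℕ} {gens : Fin n → ↥(P ⊓ C.geom)}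
    (hfree : IsFreeProOn ↥(P ⊓ C.geom) S gens) (hn : 2 ≤ n) (h2 : 2 ∈ S) (h3 : 3 ∈ S) :
    semiEllipticDoubleCoverSubgroups C = ∅ := by
  classical
  ext J
  simp only [Set.mem_empty_iff_false, iff_false]
  rintro ⟨hJopen, hJ2, htf⟩
  haveI : J.Normal := Subgroup.normal_of_index_eq_two hJ2
  -- `H := J ∩ (P ∩ Δ_C)` inside the free group `P ∩ Δ_C`
  have hidx : (J.subgroupOf (P ⊓ C.geom)).index ∣ 2 := by
    have hrel : J.relIndex (P ⊓ C.geom) ∣ J.index := Subgroup.relIndex_dvd_index_of_normal J (P ⊓ C.geom)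
    rwa [hJ2] at hrel
  obtain ⟨ψ, hker, hψ⟩ :=
    exists_surjective_S3_of_index_dvd_two_of_isFreeProOn hfree hn h2 h3 (J.subgroupOf (P ⊓ C.geom)) hidx
  -- `H` is a closed subgroup of the compact `P ∩ Δ_C`
  haveI : CompactSpace ↥(P ⊓ C.geom) := compactSpace_inf_geom C P hP
  have hHcl : IsClosed ((J.subgroupOf (P ⊓ C.geom) : Subgroup ↥(P ⊓ C.geom)) : Set ↥(P ⊓ C.geom)) := by
    have hset : ((J.subgroupOf (P ⊓ C.geom) : Subgroup ↥(P ⊓ C.geom)) : Set ↥(P ⊓ C.geom)) =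
        Subtype.val ⁻¹' (J : Set C.arith) := by
      ext z; rfl
    rw [hset]
    exact (Subgroup.isClosed_of_isOpen J hJopen).preimage continuous_subtype_val
  haveI : CompactSpace ↥(J.subgroupOf (P ⊓ C.geom)) := isCompact_iff_compactSpace.mp hHcl.isCompact
  -- `H ↪ J ∩ Δ_C`, so unique roots would descend to `H`
  let ι : ↥(J.subgroupOf (P ⊓ C.geom)) →* ↥(J ⊓ C.geom) :=
    MonoidHom.codRestrict ((P ⊓ C.geom).subtype.comp (J.subgroupOf (P ⊓ C.geom)).subtype) (J ⊓ C.geom)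
      (fun z => Subgroup.mem_inf.mpr
        ⟨Subgroup.mem_subgroupOf.mp z.2, (Subgroup.mem_inf.mp z.1.2).2⟩)
  have hι : Function.Injective ι := by
    intro z w hzw
    apply Subtype.ext
    apply Subtype.ext
    exact congrArg (fun v : ↥(J ⊓ C.geom) => (v : C.arith)) hzw
  haveI : IsMulTorsionFree ↥(J.subgroupOf (P ⊓ C.geom)) := Function.Injective.isMulTorsionFree ι hι
  exact not_isMulTorsionFree_of_surjective_S3 ψ hker hψ ‹_›

end Cor33

open Literature.IUT.HodgeTheaters in
/-- **At `D : PuncturedEllipticData` ([IUTchI] §1) under the origin datum "(A) `Δ_X := Π_X ∩ Δ_C` free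
profinite on `n ≥ 2` generators", the typed RHS of [AbsTopII] Cor. 3.3 (ii) at `Π_C` is EMPTY** —
whereas print ([IUTchI] Cor. 1.2 proof p. 39: "the algorithms of [AbsTopII], Corollary 3.3, (i), (ii) …
allow one to reconstruct … the subgroups `Δ_X ⊆ Δ_C ⊆ Π_C`") reads the collection as NON-empty — it contains
`Π_X`, and every member has geometric part `Δ_X` ([AbsTopII] Rmk. 3.1.1: `D_k̄ → C_k̄` is "the unique [up to
isomorphism over `C_k̄`] finite étale double covering of `C_k̄` by a hyperbolic curve").
[cite: MochizukiAbsTopII2013, Cor 3.3 (ii) p.68] -/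
theorem cor12_semiEllipticDoubleCoverSubgroups_eq_empty_of_isFreeProOn (D : PuncturedEllipticData.{u})
    {n : ℕ} {gens : Fin n → ↥(D.PiX ⊓ D.DeltaC)} (hfree : IsFreeProOn ↥(D.PiX ⊓ D.DeltaC) Set.univ gens)
    (hn : 2 ≤ n) : AbsTopII.semiEllipticDoubleCoverSubgroups D.E = ∅ :=
  semiEllipticDoubleCoverSubgroups_eq_empty_of_isFreeProOn D.E D.PiX D.isOpen_piX hfree hn
    (Set.mem_univ 2) (Set.mem_univ 3)

open Literature.IUT.HodgeTheaters in
/-- **The legacy LAW binder `huniq′` of the [IUTchI] Cor. 1.2 closer chain is CONTENT-FREE at the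
genuine datum**: under "(A) `Δ_X` free profinite on `n ≥ 2` generators" at `D`, EVERY property holds of
every member of `semiEllipticDoubleCoverSubgroups Π_C` — there is none.  (Companion of p493804
`cor12_htf_false_of_isFreeProOn`: of the two Cor. 3.3 (ii)-side binders of the chain, `htf` is
unsatisfiable and `huniq′` is trivially true; applies verbatim at `D := D'.geom.pe` for the
`InitialThetaData`-level closers.) [cite: MochizukiAbsTopII2013, Cor 3.3 (ii) p.68] -/
theorem cor12_forall_mem_semiEllipticDoubleCoverSubgroups_of_isFreeProOn (D : PuncturedEllipticData.{u})
    {n : ℕ} {gens : Fin n → ↥(D.PiX ⊓ D.DeltaC)} (hfree : IsFreeProOn ↥(D.PiX ⊓ D.DeltaC) Set.univ gens)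
    (hn : 2 ≤ n) (Q : Subgroup D.PiC → Prop) :
    ∀ J ∈ AbsTopII.semiEllipticDoubleCoverSubgroups D.E, Q J := by
  intro J hJ
  rw [cor12_semiEllipticDoubleCoverSubgroups_eq_empty_of_isFreeProOn D hfree hn] at hJ
  exact absurd hJ (Set.notMem_empty J)

open Literature.IUT.HodgeTheaters in
/-- **`huniq′` in its LITERAL shape** (`PuncturedEllipticCoveringsCor12Thm26.lean` l.110 and 19 further
L5 closers, census R43 §A; CERT law of `layer5_held_cor12_v3…v6`):
`∀ J ∈ semiEllipticDoubleCoverSubgroups Π_C, J ⊓ Δ_C = Π_X ⊓ Δ_C` holds TRIVIALLY under (A).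
[cite: MochizukiAbsTopII2013, Cor 3.3 (ii) p.68] -/
theorem cor12_huniq'_of_isFreeProOn (D : PuncturedEllipticData.{u}) {n : ℕ}
    {gens : Fin n → ↥(D.PiX ⊓ D.DeltaC)} (hfree : IsFreeProOn ↥(D.PiX ⊓ D.DeltaC) Set.univ gens)
    (hn : 2 ≤ n) :
    ∀ J ∈ AbsTopII.semiEllipticDoubleCoverSubgroups D.E, J ⊓ D.DeltaC = D.PiX ⊓ D.DeltaC :=
  cor12_forall_mem_semiEllipticDoubleCoverSubgroups_of_isFreeProOn D hfree hn _

end Summit.ABC.IUTFork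

end
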